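import Mathlib
import HarnessLib
import Literature.Analysis.Complex.SimplyConnectedOfCompl
import Literature.Topology.PlaneTopology.JordanCurve
import Literature.Probability.RandomPlanarGeometry.JordanDomainProofs

/-!
# Werner determination (route SAWLoopLift, item stmt-CriticalPhenomena-4851) — plane topology of
"surrounding" and of open sets without holes

Helper file (`--supports stmt-CriticalPhenomena-4851`). The route item `WernerDetermination` speaks of
compact sets `T ⊆ ℂ` *surrounding* a point `z`, written `z ∉ T ∧ IsBounded (connectedComponentIn Tᶜ z)`,
and of events `{T ⊆ U ∧ z ∉ T ∧ IsBounded (connectedComponentIn Tᶜ z)}` for Jordan domains `U`. The proof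
of the item (Werner, arXiv:math/0511605, proof of Prop. 3 / Lemma 4) replaces Jordan domains by the
intersection-stable class of open sets `W` WITHOUT HOLES, `∀ a ∈ Wᶜ, ¬ IsBounded (connectedComponentIn Wᶜ a)`
(the hypothesis of `Complex.isSimplyConnected_of_compl`, Conway VIII.2.2 (c) ⇒ (a)). This file collects the
elementary point-set topology:

* far points lie in the unbounded component of `Tᶜ`; two unbounded components of `Tᶜ` coincide;
* `mem_of_forall_not_isBounded` — a set without holes containing `T` contains every point surrounded by `T`;
* sets without holes: complements of connected unbounded closed sets, Jordan domains, balls, finite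
  intersections, and the connected component of a point in an open set without holes (hence that
  component is simply connected);
* a connected compact set surrounding `z` inside a set without holes lies in the component of `z`;
* exterior points of a compact set are exactly the points joined to infinity by a closed connected
  unbounded set missing `T`.

No new definitions. References: W. Werner, *The conformally invariant measure on self-avoiding loops*,
J. Amer. Math. Soc. 21 (2008), §3; J. B. Conway, *Functions of One Complex Variable I* (1978), VIII.2.2.
-/

noncomputable section

namespace Summit.CriticalPhenomena.SAWScalingLimit.Theorems.WernerDetermination

open Set Metric Bornology Topology Filter
open Literature.Topology.PlaneTopology (isConnected_setOf_lt_norm not_isBounded_setOf_lt_norm)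

/-! ### Far points and the unbounded component -/

/-- If `T ⊆ closedBall 0 ρ` then the connected region `{ρ < ‖z‖}` lies in the component of `Tᶜ` of
any of its points. [folklore] -/
theorem setOf_lt_norm_subset_connectedComponentIn {T : Set ℂ} {ρ : ℝ} (hρ : 0 ≤ ρ)
    (hT : T ⊆ closedBall 0 ρ) {w : ℂ} (hw : ρ < ‖w‖) :
    {z : ℂ | ρ < ‖z‖} ⊆ connectedComponentIn Tᶜ w := by
  refine (isConnected_setOf_lt_norm hρ).isPreconnected.subset_connectedComponentIn hw ?_
  intro z hz hzT
  have := hT hzT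
  rw [mem_closedBall, dist_zero_right] at this
  exact absurd (lt_of_lt_of_le hz this) (lt_irrefl _)

/-- A point of norm `> ρ` lies in an unbounded component of the complement of any `T ⊆ closedBall 0 ρ`.
[folklore] -/
theorem not_isBounded_connectedComponentIn_of_lt_norm {T : Set ℂ} {ρ : ℝ} (hρ : 0 ≤ ρ)
    (hT : T ⊆ closedBall 0 ρ) {w : ℂ} (hw : ρ < ‖w‖) :
    ¬ IsBounded (connectedComponentIn Tᶜ w) := fun h =>
  not_isBounded_setOf_lt_norm ρ (h.subset (setOf_lt_norm_subset_connectedComponentIn hρ hT hw))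

/-- An unbounded component of the complement of a bounded set contains a point of arbitrarily large
norm. [folklore] -/
theorem exists_mem_connectedComponentIn_lt_norm {F : Set ℂ} {w : ℂ}
    (hw : ¬ IsBounded (connectedComponentIn F w)) (ρ : ℝ) :
    ∃ z ∈ connectedComponentIn F w, ρ < ‖z‖ := by
  by_contra h
  push Not at h
  exact hw ((isBounded_closedBall (x := (0 : ℂ)) (r := ρ)).subset fun z hz => by
    simpa only [mem_closedBall, dist_zero_right] using h z hz)

/-- **Two unbounded components of the complement of a bounded set coincide** (both contain the
connected region `{ρ < ‖z‖}` for `ρ` large). [folklore] -/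
theorem connectedComponentIn_eq_of_not_isBounded {T : Set ℂ} (hT : IsBounded T) {v w : ℂ}
    (hv : ¬ IsBounded (connectedComponentIn Tᶜ v)) (hw : ¬ IsBounded (connectedComponentIn Tᶜ w)) :
    connectedComponentIn Tᶜ v = connectedComponentIn Tᶜ w := by
  obtain ⟨ρ, hρ⟩ := hT.subset_closedBall 0
  set ρ' : ℝ := max ρ 0 with hρ'
  have hT' : T ⊆ closedBall 0 ρ' := hρ.trans (closedBall_subset_closedBall (le_max_left _ _))
  obtain ⟨a, ha, hρa⟩ := exists_mem_connectedComponentIn_lt_norm hv ρ'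
  obtain ⟨b, hb, hρb⟩ := exists_mem_connectedComponentIn_lt_norm hw ρ'
  rw [connectedComponentIn_eq ha, connectedComponentIn_eq hb]
  exact connectedComponentIn_eq
    (setOf_lt_norm_subset_connectedComponentIn (le_max_right _ _) hT' hρa hρb)

/-! ### Sets without holes -/

/-- **A set without holes containing `T` contains every point surrounded by `T`**: if every point of
`Wᶜ` has an unbounded component in `Wᶜ` and `T ⊆ W`, then any `a` whose component in `Tᶜ` is bounded lies
in `W` (otherwise its component in `Wᶜ ⊆ Tᶜ` would be bounded). [folklore] -/
theorem mem_of_forall_not_isBounded {W T : Set ℂ}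
    (hW : ∀ a ∈ Wᶜ, ¬ IsBounded (connectedComponentIn Wᶜ a)) (hTW : T ⊆ W) {a : ℂ}
    (ha : IsBounded (connectedComponentIn Tᶜ a)) : a ∈ W := by
  by_contra haW
  exact hW a haW (ha.subset (connectedComponentIn_mono a (compl_subset_compl.2 hTW)))

/-- A set whose complement is preconnected and unbounded has no holes. [folklore] -/
theorem forall_not_isBounded_of_isPreconnected_compl {W : Set ℂ} (hc : IsPreconnected Wᶜ)
    (hb : ¬ IsBounded Wᶜ) : ∀ a ∈ Wᶜ, ¬ IsBounded (connectedComponentIn Wᶜ a) := fun _ ha h =>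
  hb (h.subset (hc.subset_connectedComponentIn ha Subset.rfl))

/-- The complement of a connected unbounded set `F` has no holes (stated for `W = Fᶜ`). [folklore] -/
theorem forall_not_isBounded_compl_compl {F : Set ℂ} (hc : IsPreconnected F) (hb : ¬ IsBounded F) :
    ∀ a ∈ Fᶜᶜ, ¬ IsBounded (connectedComponentIn Fᶜᶜ a) := by
  rw [compl_compl]
  exact fun a ha h => hb (h.subset (hc.subset_connectedComponentIn ha Subset.rfl))

/-- The complement of a bounded set is unbounded. [folklore] -/
theorem not_isBounded_compl {W : Set ℂ} (hW : IsBounded W) : ¬ IsBounded Wᶜ := fun h => by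
  have : IsBounded (univ : Set ℂ) := by rw [← union_compl_self W]; exact hW.union h
  exact NormedSpace.unbounded_univ ℝ ℂ this

/-- **Jordan domains have no holes**: the complement of a Jordan domain is connected
(`JordanDomain.isPreconnected_compl`) and unbounded. [folklore] -/
theorem forall_not_isBounded_jordanDomain (U : Literature.Probability.RandomPlanarGeometry.JordanDomain) :
    ∀ a ∈ U.carrierᶜ, ¬ IsBounded (connectedComponentIn U.carrierᶜ a) :=
  forall_not_isBounded_of_isPreconnected_compl U.isPreconnected_compl (not_isBounded_compl U.isBounded)

/-- The region `{w | r < dist w c}` outside a closed disc is connected (`0 ≤ r`). [folklore] -/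
theorem isConnected_setOf_lt_dist (c : ℂ) {r : ℝ} (hr : 0 ≤ r) : IsConnected {w : ℂ | r < dist w c} := by
  have h := (isConnected_setOf_lt_norm hr).image (fun z : ℂ => z + c) (by fun_prop)
  convert h using 1
  ext w
  simp only [mem_setOf_eq, mem_image]
  constructor
  · intro hw
    exact ⟨w - c, by simpa [dist_eq_norm] using hw, by ring⟩
  · rintro ⟨z, hz, rfl⟩
    simpa [dist_eq_norm] using hz

/-- The complement of an open disc is preconnected. [folklore] -/
theorem isPreconnected_compl_ball (c : ℂ) (r : ℝ) : IsPreconnected (ball c r)ᶜ := by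
  rcases le_or_gt r 0 with hr | hr
  · rw [Metric.ball_eq_empty.2 hr, compl_empty]
    exact isPreconnected_univ
  · have h1 : (ball c r)ᶜ = closure (closedBall c r)ᶜ := by
      rw [closure_compl, interior_closedBall c hr.ne']
    have h2 : (closedBall c r)ᶜ = {w : ℂ | r < dist w c} := by
      ext w; simp [not_le]
    rw [h1, h2]
    exact (isConnected_setOf_lt_dist c hr.le).isPreconnected.closure

/-- **Open discs have no holes.** [folklore] -/
theorem forall_not_isBounded_ball (c : ℂ) (r : ℝ) :
    ∀ a ∈ (ball c r)ᶜ, ¬ IsBounded (connectedComponentIn (ball c r)ᶜ a) :=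
  forall_not_isBounded_of_isPreconnected_compl (isPreconnected_compl_ball c r)
    (not_isBounded_compl isBounded_ball)

/-- **Sets without holes are stable under intersection.** [folklore] -/
theorem forall_not_isBounded_inter {W W' : Set ℂ}
    (hW : ∀ a ∈ Wᶜ, ¬ IsBounded (connectedComponentIn Wᶜ a))
    (hW' : ∀ a ∈ W'ᶜ, ¬ IsBounded (connectedComponentIn W'ᶜ a)) :
    ∀ a ∈ (W ∩ W')ᶜ, ¬ IsBounded (connectedComponentIn (W ∩ W')ᶜ a) := by
  intro a ha h
  rw [compl_inter] at ha h
  rcases ha with ha | ha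
  · exact hW a ha (h.subset (connectedComponentIn_mono a subset_union_left))
  · exact hW' a ha (h.subset (connectedComponentIn_mono a subset_union_right))

/-! ### Components of open sets -/

/-- The closure of a component of an open set `F` adds only points outside `F`. [folklore] -/
theorem closure_connectedComponentIn_subset {F : Set ℂ} (hF : IsOpen F) (x : ℂ) :
    closure (connectedComponentIn F x) ⊆ connectedComponentIn F x ∪ Fᶜ := by
  intro b hb
  by_cases hbF : b ∈ F
  · left
    -- the component of `b` is an open neighbourhood of `b`, hence meets the component of `x`
    obtain ⟨y, hyC, hyb⟩ := mem_closure_iff_nhds.1 hb (connectedComponentIn F b)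
      (hF.connectedComponentIn.mem_nhds (mem_connectedComponentIn hbF))
    rw [connectedComponentIn_eq hyb, ← connectedComponentIn_eq hyC]
    exact mem_connectedComponentIn hbF
  · exact Or.inr hbF

/-- An open set which is nonempty and not the whole plane is not closed: some point of its closure lies
outside it. [folklore] -/
theorem exists_mem_closure_not_mem {S : Set ℂ} (hS : IsOpen S) (hne : S.Nonempty) (hS' : S ≠ univ) :
    ∃ b ∈ closure S, b ∉ S := by
  by_contra h
  push Not at h
  have hcl : IsClosed S := closure_subset_iff_isClosed.1 h
  rcases isClopen_iff.1 ⟨hcl, hS⟩ with h0 | h1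
  · exact hne.ne_empty h0
  · exact hS' h1

/-- **The component of a point in an open set without holes has no holes.** If `a ∉ C := cc(W, z)`
and `a ∉ W` this is monotonicity; if `a ∈ W` its component `C'` in `W` has a boundary point `b ∉ W`
and `closure C' ⊆ cc(Cᶜ, a)`, so the latter contains the unbounded `cc(Wᶜ, b)`. [folklore] -/
theorem forall_not_isBounded_connectedComponentIn {W : Set ℂ} (hWo : IsOpen W)
    (hW : ∀ a ∈ Wᶜ, ¬ IsBounded (connectedComponentIn Wᶜ a)) (z : ℂ) :
    ∀ a ∈ (connectedComponentIn W z)ᶜ, ¬ IsBounded (connectedComponentIn (connectedComponentIn W z)ᶜ a) := by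
  set C := connectedComponentIn W z with hC
  have hCW : C ⊆ W := connectedComponentIn_subset _ _
  intro a haC h
  by_cases haW : a ∈ W
  swap
  · exact hW a haW (h.subset (connectedComponentIn_mono a (compl_subset_compl.2 hCW)))
  by_cases hz : z ∈ W
  swap
  · have : C = ∅ := connectedComponentIn_eq_empty hz
    rw [this, compl_empty, connectedComponentIn_univ] at h
    have huniv : connectedComponent a = (univ : Set ℂ) :=
      PreconnectedSpace.connectedComponent_eq_univ a
    rw [huniv] at h
    exact NormedSpace.unbounded_univ ℝ ℂ h
  set C' := connectedComponentIn W a with hC'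
  have hC'C : C' ⊆ Cᶜ := by
    intro y hy hyC
    apply haC
    rw [hC, connectedComponentIn_eq hyC, ← connectedComponentIn_eq hy]
    exact mem_connectedComponentIn haW
  have hcl : closure C' ⊆ Cᶜ :=
    (closure_minimal hC'C (hWo.connectedComponentIn).isClosed_compl)
  have hcl' : closure C' ⊆ connectedComponentIn Cᶜ a :=
    isPreconnected_connectedComponentIn.closure.subset_connectedComponentIn
      (subset_closure (mem_connectedComponentIn haW)) hcl
  have hne : C' ≠ univ := by
    intro hu
    have : z ∈ C' := hu ▸ mem_univ z
    apply haC
    rw [hC, ← connectedComponentIn_eq this]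
    exact mem_connectedComponentIn haW
  obtain ⟨b, hb, hbC'⟩ := exists_mem_closure_not_mem hWo.connectedComponentIn
    ⟨a, mem_connectedComponentIn haW⟩ hne
  have hbW : b ∉ W := by
    rcases closure_connectedComponentIn_subset hWo a hb with h' | h'
    · exact absurd h' hbC'
    · exact h'
  have hba : connectedComponentIn Cᶜ a = connectedComponentIn Cᶜ b := connectedComponentIn_eq (hcl' hb)
  refine hW b hbW (h.subset ?_)
  rw [hba]
  exact connectedComponentIn_mono b (compl_subset_compl.2 hCW)

/-- **The component of a point in an open set without holes is simply connected**
(`Complex.isSimplyConnected_of_compl`, Conway VIII.2.2 (c) ⇒ (a)). [folklore] -/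
theorem isSimplyConnected_connectedComponentIn {W : Set ℂ} (hWo : IsOpen W)
    (hW : ∀ a ∈ Wᶜ, ¬ IsBounded (connectedComponentIn Wᶜ a)) {z : ℂ} (hz : z ∈ W) :
    IsSimplyConnected (connectedComponentIn W z) :=
  Complex.isSimplyConnected_of_compl hWo.connectedComponentIn (isConnected_connectedComponentIn_iff.2 hz)
    (forall_not_isBounded_connectedComponentIn hWo hW z)

/-- **A connected closed set surrounding `z` inside a set without holes lies in the component of `z`.**
The bounded component `I` of `z` in `Tᶜ` lies in `W` (no holes), its closure is connected, contains `z`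
and meets `T`; so `T`, being connected, lies in the component of `z`. [folklore] -/
theorem subset_connectedComponentIn_of_surround {W T : Set ℂ}
    (hW : ∀ a ∈ Wᶜ, ¬ IsBounded (connectedComponentIn Wᶜ a)) (hTW : T ⊆ W) (hTc : IsClosed T)
    (hTconn : IsPreconnected T) {z : ℂ} (hzT : z ∉ T) (hz : IsBounded (connectedComponentIn Tᶜ z)) :
    T ⊆ connectedComponentIn W z := by
  set I := connectedComponentIn Tᶜ z with hI
  have hIo : IsOpen I := hTc.isOpen_compl.connectedComponentIn
  have hzI : z ∈ I := mem_connectedComponentIn hzT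
  have hIW : I ⊆ W := fun y hy =>
    mem_of_forall_not_isBounded hW hTW (by rw [hI, connectedComponentIn_eq hy] at hz; exact hz)
  have hclI : closure I ⊆ I ∪ T := by
    have := closure_connectedComponentIn_subset hTc.isOpen_compl z
    rwa [compl_compl] at this
  have hclW : closure I ⊆ W := hclI.trans (union_subset hIW hTW)
  have hne : I ≠ univ := fun hu => NormedSpace.unbounded_univ ℝ ℂ (hu ▸ hz)
  obtain ⟨b, hb, hbI⟩ := exists_mem_closure_not_mem hIo ⟨z, hzI⟩ hne
  have hbT : b ∈ T := by
    rcases hclI hb with h' | h'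
    · exact absurd h' hbI
    · exact h'
  have hbC : b ∈ connectedComponentIn W z :=
    (isPreconnected_connectedComponentIn.closure.subset_connectedComponentIn (subset_closure hzI) hclW) hb
  rw [connectedComponentIn_eq hbC]
  exact hTconn.subset_connectedComponentIn hbT hTW

/-! ### Exterior points -/

/-- **Exterior points are the points joined to infinity off `T`.** For a compact `T` and `w ∉ T`, the
component of `w` in `Tᶜ` is unbounded iff some closed, preconnected, unbounded set containing `w` misses
`T` (a path inside the component to a point of large norm, followed by the exterior of a large disc).
[folklore] -/
theorem not_isBounded_connectedComponentIn_iff {T : Set ℂ} (hT : IsCompact T) {w : ℂ} (hw : w ∉ T) :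
    ¬ IsBounded (connectedComponentIn Tᶜ w) ↔
      ∃ F : Set ℂ, IsClosed F ∧ IsPreconnected F ∧ ¬ IsBounded F ∧ w ∈ F ∧ Disjoint F T := by
  constructor
  · intro h
    obtain ⟨ρ, hρ⟩ := hT.isBounded.subset_closedBall 0
    set ρ' : ℝ := max ρ 0 with hρ'
    have hT' : T ⊆ closedBall 0 ρ' := hρ.trans (closedBall_subset_closedBall (le_max_left _ _))
    obtain ⟨w₀, hw₀, hρw₀⟩ := exists_mem_connectedComponentIn_lt_norm h ρ'
    have hopen : IsOpen (connectedComponentIn Tᶜ w) := hT.isClosed.isOpen_compl.connectedComponentIn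
    have hpc : IsPathConnected (connectedComponentIn Tᶜ w) :=
      (hopen.isConnected_iff_isPathConnected).1 (isConnected_connectedComponentIn_iff.2 hw)
    obtain ⟨γ, hγ⟩ := hpc.joinedIn w (mem_connectedComponentIn hw) w₀ hw₀
    refine ⟨range γ ∪ (ball (0 : ℂ) ‖w₀‖)ᶜ, ?_, ?_, ?_, Or.inl ⟨0, γ.source⟩, ?_⟩
    · exact (isCompact_range γ.continuous).isClosed.union isOpen_ball.isClosed_compl
    · refine (isPreconnected_range γ.continuous).union w₀ ⟨1, γ.target⟩ ?_
        (isPreconnected_compl_ball 0 ‖w₀‖)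
      simp
    · intro hb
      exact not_isBounded_compl isBounded_ball (hb.subset subset_union_right)
    · rw [disjoint_left]
      rintro x (⟨t, rfl⟩ | hx) hxT
      · exact connectedComponentIn_subset _ _ (hγ t) hxT
      · have h1 := hT' hxT
        rw [mem_closedBall, dist_zero_right] at h1
        rw [mem_compl_iff, mem_ball, dist_zero_right, not_lt] at hx
        linarith
  · rintro ⟨F, -, hFc, hFb, hwF, hFT⟩ hb
    refine hFb (hb.subset (hFc.subset_connectedComponentIn hwF ?_))
    exact fun x hx hxT => disjoint_left.1 hFT hx hxT

end Summit.CriticalPhenomena.SAWScalingLimit.Theorems.WernerDetermination
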